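import Literature.NumberTheory.GelbartRogawski1991.Sec1
import HarnessLib

/-!
# Gelbart–Rogawski 1991, §1.1 (pp. 449–450): the three elementary matrix identities of the §1 carpet, PROVED
# (`[w,t] ∈ G`, `diag(α,β,ᾱ⁻¹) ∈ G`, the Heisenberg law of `N`)

Sibling PROOF file of the statement carpet ★ `Literature/NumberTheory/GelbartRogawski1991/Sec1.lean` (squad TG, cell
hodgecm-mathlib; planner ruling 03:07Z: discharges live in a sibling file so that carpets stay theorem-free).  The carpet
records three printed sentences of [GelbartRogawski1991] §1.1 as `Prop`-valued predicates over a field `K` with an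
involution `σ` and a trace-zero `ξ` — ★ `Sec1.HeisMemG` («`[w,t] ∈ N ⊂ G`», i.e. `ᵗ(σ[w,t]) Φ [w,t] = Φ`), ★ `Sec1.DiagMemG`
(«`diag(α, β, ᾱ⁻¹) ∈ M ⊂ G`»), ★ `Sec1.HeisMul` («`N` is the Heisenberg group attached to the `F`-vector space `E` with
symplectic form `⟨x,y⟩ = Tr_{E/F}(ξxȳ)`», as the law `[w,t][w′,t′] = [w+w′, t+t′+½Tr(ξww̄′)]`).  They are elementary
(`3 × 3` matrix algebra; the reviewer of p848432 checked them in Lean) and are proved here, so that no consumer has to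
assume them: `heisMemG_holds`, `diagMemG_holds`, `heisMul_holds`.  Recipe: `ext i j; fin_cases i <;> fin_cases j`, `simp`
with the entries of ★ `Sec1.heis` ∕ `Sec1.diagM` ∕ `Sec1.Phi` and the hypotheses (`σσ = id`, `σξ = −ξ`, `σt = t`, `σβ·β = 1`),
then `field_simp` (characteristic `≠ 2`, `α ≠ 0`) and `ring` ∕ `linear_combination`.

THEOREMS ONLY (no definition, no named fact, no instance, no notation, no `sorry`); imports ★ `Sec1` only.

Second section (`section Packets`, edition 2): KERNEL consequences of the §1.4 ∕ Introduction p. 446 packet sentences of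
the carpet (★ `Sec1Defs.EndoscopicLData.packetA_tensor` ∕ `pin_almostAll` ∕ `weil_pin_almostAll` ∕ `flags_loc`, ★ `badSet`)
with the ★ dictionaries (`GR91LocalPacket.packetShape`, `GR91Spectrum.thm511` ∕ `thm511_b` ∕ `weil_discrete`) taken as
HYPOTHESES — pure logic, nothing posited: `comp_eq_pin_of_isSplit`, `comp_eq_pin_or_eq_pis` (which member a local
component is), `badSet_nonsplit_finite` ∕ `badSet_nonsplitPlace_finite` (the set `X = {v : π_v = πˢ(ϱ)}` of the
multiplicity rule is finite — the presupposition of `|X|`), `weil_pin_almostAll_of` ∕ `weil_pin_almostAll_of_thm511_b` (the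
Introduction's a.a.-`v` sentence for `Ω` follows from Thm. 5.1.1 + the a.a.-`v` clause for A-packets; NOT the printed
order of proof, recorded as a dependence among the rows).

Third section (`section LocalDescent`, edition 3): the GLOBAL ∕ LOCAL seam of the (5.1.1) data, KERNEL-checked from the
dictionary coherence ★ `Sec1Defs.EndoscopicLData.Coherent` (clauses ★ `smul_res1_loc`, ★ `mu_loc`, ★ `weil_loc`) — pure logic,
nothing posited: `loc_gammaOf` ∕ `loc_chiOf` (the local component of `γ = μη_Eη′_E` ∕ `χ = γ¹η′` of ★ `GR91Spectrum.gammaOf` ∕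
`chiOf` IS ★ `GR91LocalPacket.gammaOf` ∕ `chiOf` of the local components, «locally or globally» §1.2 p. 450), and
`weil_comp_mem_locPacketA` ∕ `weil_gammaOf_comp_mem_locPacketA` = the printed step of the proof of Lemma 5.1.2, p. 466 L15–17
«let `(γ, ψ, χ)` be global data which specializes to `(γ_v, ψ_v, χ_v)` at `v`, and define `ϱ` in terms of `(γ, χ)`. We know that
`ω(γ, ψ, χ) ∈ Π(ϱ)` and hence locally `ω(γ_v, ψ_v, χ_v) ∈ Π(ϱ_v)`» — from Thm. 3.4 (a) (★ `GR91Spectrum.thm34a`), «`Π(ϱ)` is a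
"tensor product"» (★ `packetA_tensor`) and ★ `weil_loc` (squad TG bridge census `T/GR/TG-t02/g2/BRIDGES-GR91.md` rows E2∕G.1∕H1–H2).

## References
* [GelbartRogawski1991] S. Gelbart, J. Rogawski, *L-functions and Fourier–Jacobi coefficients for the unitary group
  `U(3)`*, Invent. Math. 105 (1991) 445–472: §1.1 p. 449 L26–36 (`Φ`, `G`, `N`, `M`), p. 450 L1–10 (`[w,t]`,
  `diag(α,β,ᾱ⁻¹)`, «`N` is the Heisenberg group …»).
* [GelbartRogawski1991] ibid. (edition 2): Introduction p. 446 L6–12 («`Π(ϱ)` is a "tensor product"», `πⁿ(ϱ_v)`, `πˢ(ϱ_v)`,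
  «Let `X = {v : π_v = πˢ(ϱ)}`», «`(−1)^{|X|} = ε(½, φ)`», «almost everywhere non-tempered»), L17–23 (`Ω`, «for almost all
  `v` … `π_v = πⁿ(ϱ_v)`»); §1.4 p. 451 L1–6 (shape of `Π(ϱ_v)`, unramified clause); Thm. 5.1.1 p. 465.
* [GelbartRogawski1991] ibid. (edition 3): §1.2 p. 450 L13–14 («locally or globally»); Thm. 3.4 (a) + (3.4.2) p. 461;
  §5.1 (5.1.1) p. 465; Lemma 5.1.2 and its proof, p. 466 L13–17.
-/

namespace Literature.NumberTheory.GelbartRogawski1991.Sec1Proofs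

open Literature.NumberTheory.GelbartRogawski1991.Sec1

variable {K : Type*} [Field K] (σ : K →+* K) (ξ : K)

/-- **`[w,t] ∈ G`** (★ `Sec1.HeisMemG`, discharged): for `σ` an involution with `σ ξ = −ξ`, characteristic `≠ 2`, and
`σ t = t`, the matrix `[w,t] = (1, wξ, ξww̄/2 + t; 0, 1, w̄; 0, 0, 1)` satisfies `ᵗ(σ[w,t]) Φ [w,t] = Φ`,
`Φ = antidiag(1, ξ, −1)`. [cite: GelbartRogawski1991, §1.1 p. 449 L33–35, p. 450 L1–3] -/
theorem heisMemG_holds : HeisMemG σ ξ := by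
  intro hσ hξ h2 w t ht
  ext i j
  fin_cases i <;> fin_cases j <;>
    simp [heis, Phi, Matrix.transpose, Matrix.map, Matrix.mul_apply, Fin.sum_univ_three, map_add, map_mul,
      map_div₀, map_ofNat, hσ, hξ, ht] <;> field_simp [h2] <;> ring

/-- **`diag(α, β, ᾱ⁻¹) ∈ G`** (★ `Sec1.DiagMemG`, discharged): for `σ` an involution, `α ≠ 0` and `σ(β) β = 1`,
`ᵗ(σ d) Φ d = Φ` for `d = diag(α, β, ᾱ⁻¹)`. [cite: GelbartRogawski1991, §1.1 p. 449 L36, p. 450 L4–6] -/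
theorem diagMemG_holds : DiagMemG σ ξ := by
  intro hσ α β hα hβ
  ext i j
  fin_cases i <;> fin_cases j <;>
    simp [diagM, Phi, Matrix.transpose, Matrix.map, Matrix.mul_apply, Fin.sum_univ_three, hσ, hα]
  · linear_combination ξ * hβ

/-- **The Heisenberg law of `N`** (★ `Sec1.HeisMul`, discharged): for `σ` an involution with `σ ξ = −ξ` and characteristic
`≠ 2`, `[w,t][w′,t′] = [w + w′, t + t′ + ½ Tr_{E/F}(ξ w w̄′)]` (`Tr_{E/F}(x) = x + σx`).
[cite: GelbartRogawski1991, §1.1 p. 450 L7–8] -/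
theorem heisMul_holds : HeisMul σ ξ := by
  intro hσ hξ h2 w t w' t'
  ext i j
  fin_cases i <;> fin_cases j <;>
    simp [heis, Matrix.mul_apply, Fin.sum_univ_three, map_add, map_mul, hσ, hξ] <;>
    (try field_simp [h2]) <;> ring

/-! ## Kernel consequences of the packet sentences of §1.4 ∕ Introduction p. 446 (★ `Sec1.lean`, namespace
`Sec1Defs.EndoscopicLData`) together with the ★ dictionaries `GR91Spectrum` ∕ `GR91LocalPacket`

Pure logic over ★ named facts taken as hypotheses (no new statement is posited): which member of the local A-packet a
local component is (`packetA_tensor` + ★ `packetShape`), the finiteness of the printed set `X = {v : π_v = πˢ(ϱ)}` that the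
exponent `|X|` of the multiplicity rule presupposes (`pin_almostAll` + ★ `packetShape`), and the dependence of the
Introduction's row `weil_pin_almostAll` on Thm. 5.1.1 + `pin_almostAll`. -/

section Packets

open Sec1Defs (EndoscopicLData)

universe u

variable {X : GR91Spectrum.{u}} {HeckeE HeckeF : Type u} [CommGroup HeckeE] [CommGroup HeckeF]
  (D : EndoscopicLData X HeckeE HeckeF)

/-- **K — at a place that splits in `E`, every member of `Π(ϱ)` has local component `πⁿ(ϱ_v)`** («If `v` is split, then
`Π(ϱ_v) = {πⁿ(ϱ_v)}`», §1.4 p. 451 L1–2 = ★ `GR91LocalPacket.packetShape`, with «`Π(ϱ)` is a "tensor product" `⊗Π(ϱ_v)`»,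
Introduction p. 446 L6 = ★ `packetA_tensor`).  Logic only. [cite: GelbartRogawski1991, §1.4 p. 451 L1–2; Introduction p. 446 L6] -/
theorem comp_eq_pin_of_isSplit (hA : D.packetA_tensor) (hshape : ∀ v : D.Place, (D.loc v).packetShape)
    {η η' : X.Char1} {π : X.Rep} (hπ : π ∈ X.packetA η η') (v : D.Place) (hs : (D.loc v).IsSplit) :
    D.comp π v = (D.loc v).pin (D.locChar η v) (D.locChar η' v) := by
  have hmem := hA η η' π hπ v
  rw [((hshape v) (D.locChar η v) (D.locChar η' v)).1 hs] at hmem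
  exact Set.mem_singleton_iff.mp hmem

/-- **K — the local component of a member of `Π(ϱ)` is `πⁿ(ϱ_v)`, or `v` remains prime and it is the other member
`πˢ(ϱ_v) ≠ πⁿ(ϱ_v)`** («For all `v`, `Π(ϱ_v)` contains a certain non-tempered representation `πⁿ(ϱ_v)`, and it contains an
additional representation `πˢ(ϱ_v)` precisely when `v` remains prime in `E`», Introduction p. 446 L6–8; from ★
`packetA_tensor` and ★ `GR91LocalPacket.packetShape`).  Logic only.
[cite: GelbartRogawski1991, Introduction p. 446 L6–8; §1.4 p. 451 L1–3] -/
theorem comp_eq_pin_or_eq_pis (hA : D.packetA_tensor) (hshape : ∀ v : D.Place, (D.loc v).packetShape)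
    {η η' : X.Char1} {π : X.Rep} (hπ : π ∈ X.packetA η η') (v : D.Place) :
    D.comp π v = (D.loc v).pin (D.locChar η v) (D.locChar η' v) ∨
      (¬ (D.loc v).IsSplit ∧ D.comp π v = (D.loc v).pis (D.locChar η v) (D.locChar η' v) ∧
        (D.loc v).pis (D.locChar η v) (D.locChar η' v) ≠ (D.loc v).pin (D.locChar η v) (D.locChar η' v)) := by
  by_cases hs : (D.loc v).IsSplit
  · exact Or.inl (comp_eq_pin_of_isSplit D hA hshape hπ v hs)
  · have hmem := hA η η' π hπ v
    obtain ⟨hset, hne⟩ := ((hshape v) (D.locChar η v) (D.locChar η' v)).2 hs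
    simp only [hset, Set.mem_insert_iff, Set.mem_singleton_iff] at hmem
    rcases hmem with h | h
    · exact Or.inl h
    · exact Or.inr ⟨hs, h, hne⟩

/-- **K — the printed set `X = {v : π_v = πˢ(ϱ)}` (★ `badSet`) is FINITE on the places that remain prime in `E`**, for a
member `π` of the A-packet `Π(ϱ)`, `ϱ = (η, η′)`: the presupposition of the exponent `|X|` in «an element `π` of `Π(ϱ)` is
discrete … if and only if `(−1)^{|X|} = ε(½, φ)`» (Introduction p. 446 L8–10), obtained from «`π_v = πⁿ(ϱ_v)` for almost
all `v`» (★ `pin_almostAll`, §1.4 p. 451 L5–6) and «another irreducible representation `πˢ(ϱ_v)`» (`πˢ ≠ πⁿ` at non-split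
`v`, ★ `GR91LocalPacket.packetShape`).  (At a split `v` the socket `pis` is junk, whence the restriction; `πˢ(ϱ_v)` is only
defined when `v` remains prime.)  Logic only. [cite: GelbartRogawski1991, Introduction p. 446 L8–12; §1.4 p. 451 L1–6] -/
theorem badSet_nonsplit_finite (hpin : D.pin_almostAll) (hshape : ∀ v : D.Place, (D.loc v).packetShape)
    {η η' : X.Char1} {π : X.Rep} (hπ : π ∈ X.packetA η η') :
    {v : D.Place | v ∈ D.badSet η η' π ∧ ¬ (D.loc v).IsSplit}.Finite := by
  refine (hpin η η' π hπ).subset ?_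
  rintro v ⟨hv, hs⟩
  have hne := (((hshape v) (D.locChar η v) (D.locChar η' v)).2 hs).2
  simp only [Sec1Defs.EndoscopicLData.badSet, Set.mem_setOf_eq] at hv
  simp only [Set.mem_setOf_eq, hv]
  exact hne

/-- **K — the same finiteness read with the global flag «`v` is split»** of the datum (`D.IsSplitPlace`), under the
dictionary coherence ★ `flags_loc` (`IsSplitPlace v ↔ (loc v).IsSplit`). Logic only.
[cite: GelbartRogawski1991, Introduction p. 446 L8–12; §1.1 p. 449 L21–23] -/
theorem badSet_nonsplitPlace_finite (hpin : D.pin_almostAll) (hshape : ∀ v : D.Place, (D.loc v).packetShape)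
    (hflags : D.flags_loc) {η η' : X.Char1} {π : X.Rep} (hπ : π ∈ X.packetA η η') :
    {v : D.Place | v ∈ D.badSet η η' π ∧ ¬ D.IsSplitPlace v}.Finite := by
  refine (badSet_nonsplit_finite D hpin hshape hπ).subset ?_
  rintro v ⟨hv, hs⟩
  exact ⟨hv, fun h => hs (((hflags v).1).2 h)⟩

/-- **K — dependence among the rows: the Introduction's «if `π ∈ Ω`, then for almost all `v`, there is a character `ϱ_v` of
`H_v` such that `π_v = πⁿ(ϱ_v)`» (★ `weil_pin_almostAll`) FOLLOWS from Thm. 5.1.1 (a) ⇒ (c) (★ `GR91Spectrum.thm511`), the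
discreteness of the Weil representations (★ `GR91Spectrum.weil_discrete`) and the a.a.-`v` clause for A-packets (★
`pin_almostAll`)** — with `ϱ_v := (η_v, η′_v)` for the packet `Π(η, η′) ∋ ω(γ, ψ, χ)`.  NOT the printed order of proof (in print
this sentence, p. 446 L21–23, is an INPUT to `Ω ⊆ ⋃ Π(ϱ)` via [R, Thm. 13.3.6 (c)]); recorded so that a consumer assuming
`thm511`, `weil_discrete` and `pin_almostAll` need not assume `weil_pin_almostAll` as well.  Logic only.
[cite: GelbartRogawski1991, Introduction p. 446 L17–23; Thm. 5.1.1 p. 465; §1.4 p. 451 L5–6] -/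
theorem weil_pin_almostAll_of (hdisc : X.weil_discrete) (h511 : X.thm511) (hpin : D.pin_almostAll) :
    D.weil_pin_almostAll := by
  intro γ ψ χ
  obtain ⟨η, η', hmem⟩ := ((h511 _ (hdisc γ ψ χ)).1).1 ⟨γ, ψ, χ, rfl⟩
  exact (hpin η η' _ hmem).subset fun v hv => hv _ _

/-- **K — the same dependence through the `IsExceptional` typing of Thm. 5.1.1** (★ `GR91Spectrum.thm511_b`, via ★
`GR91Spectrum.weil_iff_mem_of_thm511_b`). Logic only.
[cite: GelbartRogawski1991, Introduction p. 446 L17–23; Thm. 5.1.1 p. 465; §1.4 p. 451 L5–6] -/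
theorem weil_pin_almostAll_of_thm511_b (hdisc : X.weil_discrete) (h511b : X.thm511_b) (hpin : D.pin_almostAll) :
    D.weil_pin_almostAll := by
  intro γ ψ χ
  obtain ⟨η, η', hmem⟩ := (X.weil_iff_mem_of_thm511_b h511b _ (hdisc γ ψ χ)).1 ⟨γ, ψ, χ, rfl⟩
  exact (hpin η η' _ hmem).subset fun v hv => hv _ _

end Packets

/-! ## The global ∕ local seam of the (5.1.1) data and the local membership step of Lemma 5.1.2 (edition 3)

Pure logic over the dictionary coherence ★ `Sec1Defs.EndoscopicLData.Coherent` (its clauses ★ `smul_res1_loc` — the ★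
actions `ν • γ = γν_E` and restrictions `γ ↦ γ¹` of `GR91Spectrum` ∕ `GR91LocalPacket` commute with `locOmega` ∕ `locChar` —,
★ `mu_loc` — `μ_v` is the local component of `μ` — and ★ `weil_loc` — `(ω(γ, ψ, χ))_v = ω(γ_v, ψ_v, χ_v)`), taken as
HYPOTHESES; nothing is posited and no statement of the carpet is altered. -/

section LocalDescent

open Sec1Defs (EndoscopicLData)

universe u

variable {X : GR91Spectrum.{u}} {HeckeE HeckeF : Type u} [CommGroup HeckeE] [CommGroup HeckeF]
  (D : EndoscopicLData X HeckeE HeckeF)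

/-- **K — the local component of `γ = μη_Eη′_E` is `μ_v η_{v,E} η′_{v,E}`**: along `locOmega` ∕ `locChar`, the global
(5.1.1) character ★ `GR91Spectrum.gammaOf η η′ = (ηη′) • μ` specialises to the local one ★ `GR91LocalPacket.gammaOf η_v η′_v`
(«`ν_E` denotes the character … (locally or globally)», §1.2 p. 450 L13–14; the specialisation used on p. 466 L15–17).  From ★
`smul_res1_loc` (clauses 1 and 3) and ★ `mu_loc`; logic only.
[cite: GelbartRogawski1991, §1.2 p. 450 L13–14; §5.1 (5.1.1) p. 465; Lem. 5.1.2 p. 466 L15–17] -/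
theorem loc_gammaOf (hsm : D.smul_res1_loc) (hmu : D.mu_loc) (η η' : X.Char1) (v : D.Place) :
    D.locOmega (X.gammaOf η η') v = (D.loc v).gammaOf (D.locChar η v) (D.locChar η' v) := by
  obtain ⟨h1, -, h3⟩ := hsm v
  simp only [GR91Spectrum.gammaOf, GR91LocalPacket.gammaOf, h1, h3, hmu v]

/-- **K — the local component of `χ = γ¹η′` is `γ_v¹ η′_v`**: the global (5.1.1) central character ★ `GR91Spectrum.chiOf η η′`
specialises along `locChar` to ★ `GR91LocalPacket.chiOf η_v η′_v` (from ★ `smul_res1_loc`, clauses 2–3, ★ `mu_loc` and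
`loc_gammaOf`); logic only. [cite: GelbartRogawski1991, §1.2 p. 450 L13–14; §5.1 (5.1.1) p. 465; Lem. 5.1.2 p. 466 L15–17] -/
theorem loc_chiOf (hsm : D.smul_res1_loc) (hmu : D.mu_loc) (η η' : X.Char1) (v : D.Place) :
    D.locChar (X.chiOf η η') v = (D.loc v).chiOf (D.locChar η v) (D.locChar η' v) := by
  obtain ⟨-, h2, h3⟩ := hsm v
  simp only [GR91Spectrum.chiOf, GR91LocalPacket.chiOf, h3, ← h2, loc_gammaOf D hsm hmu]

/-- **K — «We know that `ω(γ, ψ, χ) ∈ Π(ϱ)` and hence locally `ω(γ_v, ψ_v, χ_v) ∈ Π(ϱ_v)`»** (proof of Lemma 5.1.2, p. 466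
L16–17): for `(γ, χ)` related to `ϱ = (η, η′)` by (3.4.2) ∕ (5.1.1) (`γ = μη_Eη′_E`, `χ(γ¹)⁻¹ = η′`), the LOCAL Weil representation
`ω(γ_v, ψ_v, χ_v)` lies in the LOCAL A-packet `Π(ϱ_v)`, `ϱ_v = (η_v, η′_v)` — from Thm. 3.4 (a) (★ `GR91Spectrum.thm34a`:
`ω(γ, ψ, χ) ∈ Π(ϱ)`), «`Π(ϱ)` is a "tensor product" `⊗Π(ϱ_v)`» (★ `packetA_tensor`) and the identification `(ω(γ, ψ, χ))_v =
ω(γ_v, ψ_v, χ_v)` (★ `weil_loc`).  Logic only; the three inputs are hypotheses.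
[cite: GelbartRogawski1991, Lem. 5.1.2 p. 466 L13–17; Thm. 3.4 (a) p. 461; Introduction p. 446 L6] -/
theorem weil_comp_mem_locPacketA (h34 : X.thm34a) (hA : D.packetA_tensor) (hw : D.weil_loc)
    {γ : X.OmegaHecke} {χ η η' : X.Char1} (hγ : γ = (η * η') • X.mu) (hχ : χ * (X.res1 γ)⁻¹ = η')
    (ψ : X.AddChar) (v : D.Place) :
    (D.loc v).weil (D.locOmega γ v) (D.locAdd ψ v) (D.locChar χ v) ∈
      (D.loc v).packetA (D.locChar η v) (D.locChar η' v) := by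
  rw [← hw γ ψ χ v]
  exact hA η η' _ (h34 γ ψ χ η η' hγ hχ) v

/-- **K — the same step read with the LOCAL (5.1.1) data**: under the dictionary coherence ★ `Coherent`, Thm. 3.4 (a) and
★ `packetA_tensor`, the local Weil representation `ω(μ_vη_{v,E}η′_{v,E}, ψ_v, γ_v¹η′_v)` built from the LOCAL dictionary's
`gammaOf` ∕ `chiOf` at `(η_v, η′_v)` is a member of `Π(ϱ_v)` — the conclusion that the local K-lemma ★
`GR91LocalPacket.weil_mem_packetA` draws from Lemma 5.1.2 itself, here obtained from the GLOBAL Theorem 3.4 (a), as in the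
printed proof of the Lemma (p. 466 L13–17).  Logic only (`loc_gammaOf`, `loc_chiOf`, `weil_comp_mem_locPacketA`).
[cite: GelbartRogawski1991, Lem. 5.1.2 p. 466 L13–17; Thm. 3.4 (a) (3.4.2) p. 461; §5.1 (5.1.1) p. 465] -/
theorem weil_gammaOf_comp_mem_locPacketA (h34 : X.thm34a) (hA : D.packetA_tensor) (hcoh : D.Coherent)
    (η η' : X.Char1) (ψ : X.AddChar) (v : D.Place) :
    (D.loc v).weil ((D.loc v).gammaOf (D.locChar η v) (D.locChar η' v)) (D.locAdd ψ v)
        ((D.loc v).chiOf (D.locChar η v) (D.locChar η' v)) ∈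
      (D.loc v).packetA (D.locChar η v) (D.locChar η' v) := by
  obtain ⟨-, -, -, hmu, -, hsm, hw⟩ := hcoh
  rw [← loc_gammaOf D hsm hmu, ← loc_chiOf D hsm hmu]
  refine weil_comp_mem_locPacketA D h34 hA hw rfl ?_ ψ v
  rw [GR91Spectrum.chiOf, GR91Spectrum.gammaOf, mul_comm (X.res1 ((η * η') • X.mu)) η', mul_inv_cancel_right]

end LocalDescent

end Literature.NumberTheory.GelbartRogawski1991.Sec1Proofs
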